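import Summits.KontsevichZagierPeriods.KontsevichZagierPeriods.Theorems.RootDecompWalshStrataParab4Band

/-!
# The cone specimen `x₃² > x₀² + x₁² + x₂²`, part 1/3: Newton–Leibniz along `x₃`

Route `RootDecompWalshStrata` (cell decomp-kz, lens 4, gen 11), support toward `QuadricSignKernel`
(item stmt-KontsevichZagierPeriods-25393), slice `d = 4`: the quadric 4-cell
`(0,1)⁴ ∩ {x₃² > x₀² + x₁² + x₂²}` — the LORENTZIAN affine type (signature `(3,1)`, homogeneous;
value `q·π/24`).  The cell is the open band `|u| < x₃ < 1` over the 3-ball orthant `B³₊` of the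
paraboloid specimen; rule (3) along `x₃` with the primitive `q·x₃` and rule (1a) give
`[cell, q] − [B³₊, q(1 − |u|)] ∈ KZ.relations` — an ALGEBRAIC weight `q(1 − √(u₀² + u₁² + u₂²))`,
which part 2 makes rational by the polynomial Pythagorean chart.  0 sorry.
[KontsevichZagier2001 §1.2 rules (1), (3)]
-/

noncomputable section

open Literature.NumberTheory.Transcendental
open MeasureTheory Set
open MvPolynomial (aeval X C)
open Literature.ModelTheory.ExponentialFields (IsSemialgebraic isSemialgebraic_setOf_eval_pos
  isSemialgebraic_setOf_eval_lt continuous_aeval_real)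
open Summit.KontsevichZagierPeriods.RootDecompWalshStrata.WalshSpanProof (isSemialgebraic_cubeSet
  isBounded_cubeSet cellRep cellRep_domain cellRep_integrand)
open Summit.KontsevichZagierPeriods.RootDecompWalshStrata.Parab4 (ball3Poly aeval_ball3Poly b3Set
  isSemialgebraic_b3Set b3Set_subset_Icc snoc₃_apply)

namespace Summit.KontsevichZagierPeriods.RootDecompWalshStrata.Cone4

/-! #### The cell, the norm, and the descended representation on `B³₊` -/

/-- The Lorentzian quadric `x₃² − x₀² − x₁² − x₂²`. -/
def cone4Poly : MvPolynomial (Fin 4) ℚ := X 3 ^ 2 - X 0 ^ 2 - X 1 ^ 2 - X 2 ^ 2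

/-- Evaluation of the Lorentzian quadric. [definition] -/
@[simp] theorem aeval_cone4Poly (x : Fin 4 → ℝ) :
    aeval x cone4Poly = x 3 ^ 2 - x 0 ^ 2 - x 1 ^ 2 - x 2 ^ 2 := by
  simp [cone4Poly]

/-- The Euclidean norm `|u| = √(u₀² + u₁² + u₂²)` (the lower edge of the band). -/
def nrm (u : Fin 3 → ℝ) : ℝ := √(u 0 ^ 2 + u 1 ^ 2 + u 2 ^ 2)

/-- The norm is `ℚ`-semialgebraic on `B³₊`. [BCR1998 §2.2] -/
theorem isSemialgebraicFunOn_nrm : IsSemialgebraicFunOn ℚ b3Set nrm :=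
  (IsSemialgebraicFunOn.sqrt_holds
    (isSemialgebraicFunOn_aeval isSemialgebraic_b3Set (X 0 ^ 2 + X 1 ^ 2 + X 2 ^ 2))).congr
    fun u _ => by simp [nrm]

/-- Membership in `B³₊`, in coordinates. [definition] -/
theorem mem_b3Set {u : Fin 3 → ℝ} :
    u ∈ b3Set ↔ ((0 < u 0 ∧ u 0 < 1) ∧ (0 < u 1 ∧ u 1 < 1) ∧ (0 < u 2 ∧ u 2 < 1)) ∧
      0 < 1 - u 0 ^ 2 - u 1 ^ 2 - u 2 ^ 2 := by
  simp only [b3Set, mem_setOf_eq, aeval_ball3Poly]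
  exact ⟨fun ⟨hu, hc⟩ => ⟨⟨hu 0, hu 1, hu 2⟩, hc⟩, fun ⟨⟨h0, h1, h2⟩, hc⟩ =>
    ⟨fun j => by fin_cases j <;> assumption, hc⟩⟩

/-- On `B³₊`, `0 ≤ |u| < 1`. [folklore] -/
theorem nrm_lt_one {u : Fin 3 → ℝ} (hu : u ∈ b3Set) : 0 ≤ nrm u ∧ nrm u < 1 := by
  have h := (mem_b3Set.1 hu).2
  exact ⟨Real.sqrt_nonneg _, (Real.sqrt_lt' one_pos).2 (by linarith)⟩

/-- The descended weight `q(1 − |u|)` is continuous on `ℝ³`. [folklore] -/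
theorem continuous_wN (q : ℚ) :
    Continuous fun u : Fin 3 → ℝ => (q : ℝ) * (1 - √(u 0 ^ 2 + u 1 ^ 2 + u 2 ^ 2)) :=
  continuous_const.mul (continuous_const.sub (Real.continuous_sqrt.comp
    ((((continuous_apply 0).pow 2).add ((continuous_apply 1).pow 2)).add ((continuous_apply 2).pow 2))))

/-- `[B³₊, q(1 − |u|)]`: the representation after the first descent (an ALGEBRAIC weight on the
3-ball orthant). [KontsevichZagier2001 §1.1] -/
def b3NRep (q : ℚ) : KZ.IntegralRep 3 where
  domain := b3Set
  integrand u := (q : ℝ) * (1 - √(u 0 ^ 2 + u 1 ^ 2 + u 2 ^ 2))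
  isSemialgebraic_domain := isSemialgebraic_b3Set
  isSemialgebraicFunOn_integrand :=
    (IsSemialgebraicFunOn.mul_holds (isSemialgebraicFunOn_ratCast isSemialgebraic_b3Set q)
      (IsSemialgebraicFunOn.sub_holds (by simpa using isSemialgebraicFunOn_ratCast isSemialgebraic_b3Set 1)
        isSemialgebraicFunOn_nrm)).congr fun u _ => by
      simp only [Pi.mul_apply, Pi.sub_apply, nrm]
  integrableOn :=
    ((continuous_wN q).continuousOn.integrableOn_compact isCompact_Icc).mono_set b3Set_subset_Icc

/-- The domain of the descended representation. [definition] -/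
@[simp] theorem b3NRep_domain (q : ℚ) : (b3NRep q).domain = b3Set := rfl

/-- The integrand of the descended representation. [definition] -/
@[simp] theorem b3NRep_integrand (q : ℚ) (u : Fin 3 → ℝ) :
    (b3NRep q).integrand u = (q : ℝ) * (1 - √(u 0 ^ 2 + u 1 ^ 2 + u 2 ^ 2)) := rfl

/-! #### The cell is the open band `|u| < x₃ < 1` over `B³₊` -/

/-- Membership in the cone cell in band form. [folklore] -/
theorem mem_cell_iff_init (q : ℚ) (x : Fin 4 → ℝ) :
    x ∈ (cellRep cone4Poly q).domain ↔
      Fin.init x ∈ b3Set ∧ nrm (Fin.init x) < x (Fin.last 3) ∧ x (Fin.last 3) < 1 := by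
  rw [cellRep_domain]
  have hb3 : Fin.init x ∈ b3Set ↔
      ((0 < x 0 ∧ x 0 < 1) ∧ (0 < x 1 ∧ x 1 < 1) ∧ (0 < x 2 ∧ x 2 < 1)) ∧
        0 < 1 - x 0 ^ 2 - x 1 ^ 2 - x 2 ^ 2 := by
    rw [mem_b3Set]
    rfl
  have hcube : (∀ j : Fin 4, 0 < x j ∧ x j < 1) ↔
      (0 < x 0 ∧ x 0 < 1) ∧ (0 < x 1 ∧ x 1 < 1) ∧ (0 < x 2 ∧ x 2 < 1) ∧ (0 < x 3 ∧ x 3 < 1) :=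
    ⟨fun h => ⟨h 0, h 1, h 2, h 3⟩, fun ⟨h0, h1, h2, h3⟩ j => by fin_cases j <;> assumption⟩
  have ha : nrm (Fin.init x) = √(x 0 ^ 2 + x 1 ^ 2 + x 2 ^ 2) := rfl
  have hl : x (Fin.last 3) = x 3 := rfl
  simp only [mem_setOf_eq, aeval_cone4Poly]
  rw [hcube, hb3, ha, hl]
  constructor
  · rintro ⟨⟨h0, h1, h2, h3⟩, hP⟩
    have hsq : x 3 ^ 2 < 1 := by nlinarith [h3.1, h3.2]
    exact ⟨⟨⟨h0, h1, h2⟩, by linarith⟩, (Real.sqrt_lt' h3.1).2 (by linarith), h3.2⟩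
  · rintro ⟨⟨⟨h0, h1, h2⟩, _⟩, hlo, h3⟩
    have hx3 : 0 < x 3 := (Real.sqrt_nonneg _).trans_lt hlo
    have hP : x 0 ^ 2 + x 1 ^ 2 + x 2 ^ 2 < x 3 ^ 2 := (Real.sqrt_lt' hx3).1 hlo
    exact ⟨⟨h0, h1, h2, hx3, h3⟩, by linarith⟩

/-- The closed band `|u| ≤ x₃ ≤ 1` over `B³₊` lies in `[0,1]⁴`. [folklore] -/
theorem band_b3Set_subset_Icc' : KZlog.band b3Set nrm (fun _ => (1:ℝ)) ⊆ Icc 0 1 := by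
  intro x hx
  rw [KZlog.mem_band] at hx
  obtain ⟨hu, h0, h1⟩ := hx
  have hu' := (mem_b3Set.1 hu).1
  have hlo : 0 ≤ nrm (Fin.init x) := Real.sqrt_nonneg _
  obtain ⟨hu0, hu1, hu2⟩ := hu'
  have e0 : Fin.init x 0 = x 0 := rfl
  have e1 : Fin.init x 1 = x 1 := rfl
  have e2 : Fin.init x 2 = x 2 := rfl
  rw [e0] at hu0
  rw [e1] at hu1
  rw [e2] at hu2
  refine ⟨fun j => ?_, fun j => ?_⟩
  · fin_cases j
    · exact hu0.1.le
    · exact hu1.1.le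
    · exact hu2.1.le
    · exact hlo.trans h0
  · fin_cases j
    · exact hu0.2.le
    · exact hu1.2.le
    · exact hu2.2.le
    · exact h1

/-! #### Moves (3) + (1a): `[cell, q] ≡ [B³₊, q(1 − |u|)]` -/

/-- **Moves (3) + (1a):** Newton–Leibniz along `x₃` with the primitive `q·x₃` over `B³₊` (closed
fibres `[|u|, 1]`), then opening the fibres:
`[(0,1)⁴ ∩ {x₃² > |u|²}, q] − [B³₊, q(1 − |u|)] ∈ KZ.relations` (`4 → 3`).
[KontsevichZagier2001 §1.2 rules (1), (3); this node] -/
theorem of_cell_sub_of_b3NRep_mem_relations (q : ℚ) :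
    KZ.of (cellRep cone4Poly q) - KZ.of (b3NRep q) ∈ KZ.relations := by
  have hBs := isSemialgebraic_b3Set
  have ha : IsSemialgebraicFunOn ℚ b3Set nrm := isSemialgebraicFunOn_nrm
  have hb : IsSemialgebraicFunOn ℚ b3Set (fun _ => (1:ℝ)) := by
    simpa using isSemialgebraicFunOn_ratCast hBs 1
  have hab : ∀ u ∈ b3Set, nrm u ≤ (fun _ => (1:ℝ)) u := fun u hu => (nrm_lt_one hu).2.le
  have hband : IsSemialgebraic ℚ (KZlog.band b3Set nrm (fun _ => (1:ℝ))) :=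
    KZlog.isSemialgebraic_band ha hb
  have hbdry : ∀ u ∈ b3Set,
      (q : ℝ) * (Fin.snoc u ((fun _ => (1:ℝ)) u) : Fin 4 → ℝ) 3 -
        (q : ℝ) * (Fin.snoc u (nrm u) : Fin 4 → ℝ) 3 = (b3NRep q).integrand u := by
    intro u _
    simp only [snoc₃_apply, b3NRep_integrand, nrm]
    ring
  obtain ⟨rb, rd, hrbd, hrbi, hrdd, hrdi, hrel⟩ := KZ.exists_band_newtonLeibniz hBs
    nrm (fun _ => (1:ℝ)) ha hb hab
    (fun x => (q : ℝ) * x 3) (fun _ => (q : ℝ))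
    ((isSemialgebraicFunOn_aeval hband (C q * X 3)).congr fun x _ => by simp)
    (by simpa using isSemialgebraicFunOn_ratCast hband q)
    (fun u _ => by
      simp only [snoc₃_apply]
      exact (continuous_const.mul continuous_id).continuousOn)
    (fun u _ s _ => by
      simp only [snoc₃_apply]
      exact ((hasDerivAt_id s).const_mul (q : ℝ)).congr_deriv (mul_one _))
    ((continuous_const.continuousOn.integrableOn_compact isCompact_Icc).mono_set
      band_b3Set_subset_Icc')
    ((b3NRep q).isSemialgebraicFunOn_integrand.congr fun u hu => (hbdry u hu).symm)
    (((b3NRep q).integrableOn.congr_fun (fun u hu => (hbdry u hu).symm)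
      isSemialgebraic_b3Set.measurableSet_holds))
  obtain ⟨rb', hrb'd, hrb'i, hrel'⟩ := KZ.of_sub_of_restrict_openBand_mem_relations ha hb rb hrbd
  have hpin1 : KZ.of rb' - KZ.of (cellRep cone4Poly q) ∈ KZ.relations := by
    refine KZ.of_sub_of_mem_relations_of_eqOn ?_ fun x _ => ?_
    · rw [hrb'd]
      ext x
      exact mem_cell_iff_init q x
    · rw [hrb'i, hrbi, cellRep_integrand]
  have hpin2 : KZ.of rd - KZ.of (b3NRep q) ∈ KZ.relations := by
    refine KZ.of_sub_of_mem_relations_of_eqOn ?_ fun u hu => ?_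
    · rw [b3NRep_domain, hrdd]
    · rw [hrdi]
      rw [hrdd] at hu
      exact hbdry u hu
  have : KZ.of (cellRep cone4Poly q) - KZ.of (b3NRep q) =
      (KZ.of rb - KZ.of rd) - (KZ.of rb - KZ.of rb') - (KZ.of rb' - KZ.of (cellRep cone4Poly q)) +
        (KZ.of rd - KZ.of (b3NRep q)) := by abel
  rw [this]
  exact add_mem (sub_mem (sub_mem hrel hrel') hpin1) hpin2

end Summit.KontsevichZagierPeriods.RootDecompWalshStrata.Cone4

end
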